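import Literature.Barriers.CriticalPhenomena.SupercriticalSAWSpaceFillingBoxes
import HarnessLib

/-!
# Supercritical self-avoiding walks are space-filling (Duminil-Copin–Kozma–Yadin 2014):
# the rungs between adjacent boxes with moats and the merged polygon

First of four companion files of `SupercriticalSAWSpaceFillingBoxes.lean` proving its named fact
`DKY2014_prop7_claim` — the Claim "`Z_F(x) ≥ Z_m(x)^{|F|}`" in the proof of Proposition 7 of
H. Duminil-Copin, G. Kozma, A. Yadin, *Supercritical self-avoiding walks are space-filling*,
Ann. IHP Probab. Stat. 50 (2014) 315–326, arXiv:1110.3074, §3, for the boxes with moats of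
that file (`DKY2014_prop7_claim_holds` in `SupercriticalSAWSpaceFillingBoxesProofs.lean`).
The printed proof: "If the cardinality of `F` is 1, `Z_F(x) = Z_m(x)` by definition. … There
exists a box `B` in `F₀` such that `F₀ ∖ {B}` is still connected. … `B` is adjacent to a box
`B' ∈ F₀ ∖ {B}` so that one of the four cardinal edges (called `[ab]`) of `B` is adjacent to a
cardinal edge `[cd]` of `B'`. Note that `[cd]` belongs to `𝓔𝓒_{F₀∖{B}}`. Then, by changing the
edges `[cd]` and `[ab]` of `γ` and `γ'` into the edges `[ac]` and `[bd]`, one obtains a polygon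
in `S_F`. Furthermore, the construction is one-to-one and we deduce
`Z_{F₀}(x) ≥ Z_{F₀∖{B}}(x) Z_B(x) ≥ Z_m(x)^{|F₀|}`."

This file sets up the objects of that proof over the boxes with moats (`innerBox`,
`innerCardinalEdge`, `rungCells`, `polygonRegion`, `familyPolygons = S_F`,
`familyPartition = Z_F` of `SupercriticalSAWSpaceFillingBoxes.lean`):

* unfolding lemmas for `familyPolygons`, `polygonRegion` (`mem_familyPolygons_iff`,
  `mem_polygonRegion_iff`, `polygonRegion_mono`, …) and for `dirVec`;
* `shiftEdges c E` — the translate `E + c` of an edge set (used with `c` the inner corner of a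
  box, to place a polygon of `P_n` in its inner box: the case `|F| = 1`);
* `rungPt n g z i k t` — the rung points of `B(z)` towards `+eᵢ` (index `0`: the endpoints of
  the inner cardinal edge of `B(z)` on the side `(i,+)`; index `2g+1`: those of the inner
  cardinal edge of `B(z + eᵢ)` on the side `(i,-)`, `innerCardinalEdge_true_eq`,
  `innerCardinalEdge_false_eq`; indices `1 ≤ k ≤ 2g`: the rung cells, `mem_rungCells_iff`),
  with their coordinates and adjacencies;
* `rungEdges n g z i` — the `2(2g+1)` edges of the two lattice paths along the rung (for
  `g = 0`, the two edges "`[ac]` and `[bd]`"), `mem_rungEdges_iff`;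
* `mergeEdges n g z i U` — the merge: delete the two inner cardinal edges facing each other
  across the rung from `U` and add the rung edges;
* `MergeData n g z i R₁ R₂ E₁ E₂` — the hypotheses of the merge: two polygons `E₁ ⊆ 𝓔(R₁)`,
  `E₂ ⊆ 𝓔(R₂)` through the two facing cardinal edges, in disjoint regions avoiding the rung
  cells (instantiated both ways round in `…BoxesProofs`: the new box `B` may sit on either
  side of the box of `F₀ ∖ {B}` it is merged with).

The merge is proved to be a polygon of the right size, injectively, in
`SupercriticalSAWSpaceFillingBoxesMerge.lean`; translations are treated in
`SupercriticalSAWSpaceFillingBoxesShift.lean`.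
-/

noncomputable section

open SimpleGraph Literature.Probability.LatticeModels Literature.Probability.Percolation
  Literature.Probability.RandomPlanarGeometry.SAW

namespace Literature.Barriers.CriticalPhenomena

namespace SupercriticalSAW

/-! ### Unfolding the family objects -/

/-- Membership in `S_F`, unfolded. [cite: DuminilCopinKozmaYadin2014, §3 (proof of Proposition 7, S_F)] -/
theorem mem_familyPolygons_iff {n g : ℕ} {F : Finset (Site 2)} {E : Finset (Sym2 (Site 2))} :
    E ∈ familyPolygons n g F ↔ E ⊆ edgesIn (zdGraph 2) (polygonRegion n g F) ∧
      IsPolygon (zdGraph 2) E ∧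
      ∀ z ∈ F, ∀ (i : Fin 2) (s : Bool), z + dirVec i s ∉ F → innerCardinalEdge n g z i s ∈ E := by
  classical
  rw [familyPolygons, Finset.mem_filter, Finset.mem_powerset]

/-- The inner box of a box of `F` lies in the polygon region of `F`.
[cite: DuminilCopinKozmaYadin2014, §3 (V_F)] -/
theorem innerBox_subset_polygonRegion {n g : ℕ} {F : Finset (Site 2)} {z : Site 2} (hz : z ∈ F) :
    innerBox n g z ⊆ polygonRegion n g F := fun _ hv =>
  Finset.mem_union_left _ (Finset.mem_biUnion.2 ⟨z, hz, hv⟩)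

/-- `edgesIn` is monotone in the vertex set. [folklore] -/
theorem edgesIn_subset_of_subset {R R' : Finset (Site 2)} (h : R ⊆ R') :
    edgesIn (zdGraph 2) R ⊆ edgesIn (zdGraph 2) R' := fun e he => by
  rw [mem_edgesIn_iff] at he ⊢
  exact ⟨he.1, fun x hx => h (he.2 x hx)⟩

/-- The rung between two `+eᵢ`-adjacent boxes of `F` lies in the polygon region of `F`.
[cite: DuminilCopinKozmaYadin2014, §3 (𝓔_F)] -/
theorem rungCells_subset_polygonRegion {n g : ℕ} {F : Finset (Site 2)} {z : Site 2} {i : Fin 2}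
    (hz : z ∈ F) (hz' : z + Pi.single i 1 ∈ F) : rungCells n g z i ⊆ polygonRegion n g F := by
  intro v hv
  refine Finset.mem_union_right _ (Finset.mem_biUnion.2 ⟨i, Finset.mem_univ _, ?_⟩)
  exact Finset.mem_biUnion.2 ⟨z, Finset.mem_filter.2 ⟨hz, hz'⟩, hv⟩

/-- Membership in the polygon region, unfolded. [cite: DuminilCopinKozmaYadin2014, §3 (𝓔_F)] -/
theorem mem_polygonRegion_iff {n g : ℕ} {F : Finset (Site 2)} {v : Site 2} :
    v ∈ polygonRegion n g F ↔ (∃ z ∈ F, v ∈ innerBox n g z) ∨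
      ∃ (i : Fin 2), ∃ z ∈ F, z + Pi.single i 1 ∈ F ∧ v ∈ rungCells n g z i := by
  simp only [polygonRegion, Finset.mem_union, Finset.mem_biUnion, Finset.mem_univ, true_and,
    Finset.mem_filter]
  constructor
  · rintro (h | ⟨i, z, ⟨hz, hz'⟩, hv⟩)
    · exact Or.inl h
    · exact Or.inr ⟨i, z, hz, hz', hv⟩
  · rintro (h | ⟨i, z, hz, hz', hv⟩)
    · exact Or.inl h
    · exact Or.inr ⟨i, z, ⟨hz, hz'⟩, hv⟩

/-- The polygon region is monotone in the family. [cite: DuminilCopinKozmaYadin2014, §3 (𝓔_F)] -/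
theorem polygonRegion_mono {n g : ℕ} {F F' : Finset (Site 2)} (h : F ⊆ F') :
    polygonRegion n g F ⊆ polygonRegion n g F' := by
  intro v hv
  rw [mem_polygonRegion_iff] at hv ⊢
  rcases hv with ⟨z, hz, hv⟩ | ⟨i, z, hz, hz', hv⟩
  · exact Or.inl ⟨z, h hz, hv⟩
  · exact Or.inr ⟨i, z, h hz, h hz', hv⟩

/-- `dirVec i true = eᵢ`. [cite: DuminilCopinKozmaYadin2014, §3 (adjacent boxes)] -/
theorem dirVec_true (i : Fin 2) : dirVec i true = Pi.single i 1 := by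
  simp [dirVec]

/-- `dirVec i false = -eᵢ`. [cite: DuminilCopinKozmaYadin2014, §3 (adjacent boxes)] -/
theorem dirVec_false (i : Fin 2) : dirVec i false = -Pi.single i 1 := by
  simp [dirVec, Pi.single_neg]

/-! ### Translating the polygons of `P_n` into an inner box -/

/-- The translate `E + c` of a set of edges of `ℤ²`. [folklore] -/
def shiftEdges (c : Site 2) (E : Finset (Sym2 (Site 2))) : Finset (Sym2 (Site 2)) :=
  E.image (Sym2.map fun v => v + c)

/-- Translation of edge sets is injective in the edge set. [folklore] -/
theorem shiftEdges_injective (c : Site 2) : Function.Injective (shiftEdges c) :=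
  Finset.image_injective (Sym2.map.injective (add_left_injective c))

/-- Translation preserves the number of edges. [folklore] -/
theorem card_shiftEdges (c : Site 2) (E : Finset (Sym2 (Site 2))) : (shiftEdges c E).card = E.card :=
  Finset.card_image_of_injective _ (Sym2.map.injective (add_left_injective c))

/-- Membership in a translated edge set. [folklore] -/
theorem mem_shiftEdges_iff {c : Site 2} {E : Finset (Sym2 (Site 2))} {e : Sym2 (Site 2)} :
    e ∈ shiftEdges c E ↔ ∃ e' ∈ E, Sym2.map (fun v => v + c) e' = e := by
  rw [shiftEdges, Finset.mem_image]

/-! ### Rungs: the points, the steps and the merged edge set -/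

/-- In `ℤ²`, an index different from `i` is `i + 1`. [folklore] -/
theorem fin_two_eq_add_one_of_ne {i j : Fin 2} (h : j ≠ i) : j = i + 1 := by
  revert i j; decide

/-- In `ℤ²`, `i + 1 ≠ i`. [folklore] -/
theorem fin_two_add_one_ne (i : Fin 2) : i + 1 ≠ i := by
  revert i; decide

/-- `i + 1 + 1 = i` in `Fin 2`. [folklore] -/
theorem fin_two_add_one_add_one (i : Fin 2) : i + 1 + 1 = i := by
  revert i; decide

/-- The rung points of `B(z)` towards `+eᵢ`: `rungPt k t` is the site with inner coordinates
(relative to the inner corner of `B(z)`) `2n+1+k` along `eᵢ` and `n` (`t = false`, lower row) or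
`n+1` (`t = true`, upper row) along `e_{i+1}`; `k = 0` gives the two endpoints of the inner
cardinal edge of `B(z)` on the side `(i,+)`, `k = 2g+1` those of the inner cardinal edge of
`B(z + eᵢ)` on the side `(i,-)`, and `1 ≤ k ≤ 2g` the rung cells between them.
[cite: DuminilCopinKozmaYadin2014, §3 (proof of the Claim: the edges [ac], [bd])] -/
def rungPt (n g : ℕ) (z : Site 2) (i : Fin 2) (k : ℕ) (t : Bool) : Site 2 :=
  innerCorner n g z + fun j => if j = i then 2 * (n : ℤ) + 1 + k else (n : ℤ) + if t then 1 else 0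

/-- The `i`-th coordinate of a rung point. [cite: DuminilCopinKozmaYadin2014, §3 (proof of the Claim)] -/
theorem rungPt_apply_self (n g : ℕ) (z : Site 2) (i : Fin 2) (k : ℕ) (t : Bool) :
    rungPt n g z i k t i = (2 * ((n + g : ℕ) : ℤ) + 2) * z i + g + (2 * n + 1) + k := by
  simp only [rungPt, innerCorner, Pi.add_apply, Pi.smul_apply, smul_eq_mul, if_true]
  ring

/-- The `(i+1)`-th coordinate of a rung point. [cite: DuminilCopinKozmaYadin2014, §3 (proof of the Claim)] -/
theorem rungPt_apply_next (n g : ℕ) (z : Site 2) (i : Fin 2) (k : ℕ) (t : Bool) :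
    rungPt n g z i k t (i + 1) =
      (2 * ((n + g : ℕ) : ℤ) + 2) * z (i + 1) + g + n + if t then 1 else 0 := by
  simp only [rungPt, innerCorner, Pi.add_apply, Pi.smul_apply, smul_eq_mul,
    if_neg (fin_two_add_one_ne i)]
  ring

/-- Consecutive rung points differ by `eᵢ`. [cite: DuminilCopinKozmaYadin2014, §3 (proof of the Claim)] -/
theorem rungPt_succ (n g : ℕ) (z : Site 2) (i : Fin 2) (k : ℕ) (t : Bool) :
    rungPt n g z i (k + 1) t = rungPt n g z i k t + Pi.single i 1 := by
  funext j
  by_cases hj : j = i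
  · subst hj; simp [rungPt]; ring
  · simp [rungPt, hj]

/-- The upper rung point is the lower one plus `e_{i+1}`. [cite: DuminilCopinKozmaYadin2014, §3 (proof of the Claim)] -/
theorem rungPt_true (n g : ℕ) (z : Site 2) (i : Fin 2) (k : ℕ) :
    rungPt n g z i k true = rungPt n g z i k false + Pi.single (i + 1) 1 := by
  funext j
  by_cases hj : j = i
  · subst hj; simp [rungPt, (fin_two_add_one_ne j).symm]
  · have := fin_two_eq_add_one_of_ne hj
    subst this; simp [rungPt, fin_two_add_one_ne i, add_assoc]

/-- Consecutive rung points are adjacent in `ℤ²`. [cite: DuminilCopinKozmaYadin2014, §3 (proof of the Claim)] -/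
theorem rungPt_adj_succ (n g : ℕ) (z : Site 2) (i : Fin 2) (k : ℕ) (t : Bool) :
    (zdGraph 2).Adj (rungPt n g z i k t) (rungPt n g z i (k + 1) t) :=
  (zdGraph_adj_iff _ _).2 ⟨i, Or.inl (rungPt_succ n g z i k t)⟩

/-- The two rung points with the same index are adjacent in `ℤ²`. [cite: DuminilCopinKozmaYadin2014, §3 (proof of the Claim)] -/
theorem rungPt_adj_true (n g : ℕ) (z : Site 2) (i : Fin 2) (k : ℕ) :
    (zdGraph 2).Adj (rungPt n g z i k false) (rungPt n g z i k true) :=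
  (zdGraph_adj_iff _ _).2 ⟨i + 1, Or.inl (rungPt_true n g z i k)⟩

/-- Rung points are determined by their index and row. [cite: DuminilCopinKozmaYadin2014, §3 (proof of the Claim)] -/
theorem rungPt_inj {n g : ℕ} {z : Site 2} {i : Fin 2} {k k' : ℕ} {t t' : Bool}
    (h : rungPt n g z i k t = rungPt n g z i k' t') : k = k' ∧ t = t' := by
  have hi := congrFun h i
  have hn := congrFun h (i + 1)
  rw [rungPt_apply_self, rungPt_apply_self] at hi
  rw [rungPt_apply_next, rungPt_apply_next] at hn
  constructor
  · omega
  · cases t <;> cases t'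
    · rfl
    · simp at hn
    · simp at hn
    · rfl

/-- The inner cardinal edge of `B(z)` on the side `(i,+)` joins the two rung points of index `0`.
[cite: DuminilCopinKozmaYadin2014, §3 (cardinal edges; proof of the Claim)] -/
theorem innerCardinalEdge_true_eq (n g : ℕ) (z : Site 2) (i : Fin 2) :
    innerCardinalEdge n g z i true = s(rungPt n g z i 0 false, rungPt n g z i 0 true) := by
  rw [rungPt_true]
  simp only [innerCardinalEdge, rungPt, if_true, Nat.cast_zero, add_zero, Bool.false_eq_true,
    if_false]

/-- The inner cardinal edge of `B(z + eᵢ)` on the side `(i,-)` joins the two rung points of index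
`2g+1`. [cite: DuminilCopinKozmaYadin2014, §3 (cardinal edges; proof of the Claim)] -/
theorem innerCardinalEdge_false_eq (n g : ℕ) (z : Site 2) (i : Fin 2) :
    innerCardinalEdge n g (z + Pi.single i 1) i false =
      s(rungPt n g z i (2 * g + 1) false, rungPt n g z i (2 * g + 1) true) := by
  rw [rungPt_true]
  have key : (innerCorner n g (z + Pi.single i 1) + fun j =>
      if j = i then (if false = true then 2 * (n : ℤ) + 1 else 0) else (n : ℤ)) =
      rungPt n g z i (2 * g + 1) false := by
    funext j
    by_cases hj : j = i
    · subst hj; simp [rungPt, innerCorner]; ring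
    · simp [rungPt, innerCorner, hj]
  simp only [innerCardinalEdge]
  rw [key]

/-- The rung points of index `1 ≤ k ≤ 2g` are the rung cells. [cite: DuminilCopinKozmaYadin2014, §3 (proof of the Claim)] -/
theorem mem_rungCells_iff {n g : ℕ} {z : Site 2} {i : Fin 2} {v : Site 2} :
    v ∈ rungCells n g z i ↔ ∃ k, 1 ≤ k ∧ k ≤ 2 * g ∧ ∃ t, v = rungPt n g z i k t := by
  simp only [rungCells, Finset.mem_image, Finset.mem_product, Finset.mem_range, Prod.exists]
  constructor
  · rintro ⟨a, b, ⟨ha, hb⟩, rfl⟩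
    refine ⟨a + 1, by omega, by omega, b = 1, ?_⟩
    funext j
    by_cases hj : j = i
    · subst hj; simp [rungPt]; ring
    · simp only [rungPt, hj, if_false, Pi.add_apply]
      interval_cases b <;> simp
  · rintro ⟨k, hk, hk', t, rfl⟩
    refine ⟨k - 1, if t then 1 else 0, ⟨by omega, by cases t <;> simp⟩, ?_⟩
    funext j
    by_cases hj : j = i
    · subst hj; simp [rungPt]; omega
    · cases t <;> simp [rungPt, hj]

/-- The rung edges of `B(z)` towards `+eᵢ`: the `2(2g+1)` edges of the two parallel lattice paths
of length `2g+1` from the endpoints of the inner cardinal edge of `B(z)` on the side `(i,+)` to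
those of the inner cardinal edge of `B(z + eᵢ)` on the side `(i,-)` (for `g = 0` these are the
two edges "`[ac]` and `[bd]`" of the source). [cite: DuminilCopinKozmaYadin2014, §3 (proof of the Claim)] -/
def rungEdges (n g : ℕ) (z : Site 2) (i : Fin 2) : Finset (Sym2 (Site 2)) :=
  (Finset.range (2 * g + 1)).image (fun k => s(rungPt n g z i k false, rungPt n g z i (k + 1) false)) ∪
    (Finset.range (2 * g + 1)).image fun k => s(rungPt n g z i k true, rungPt n g z i (k + 1) true)

/-- **The merge of the source** ("by changing the edges `[cd]` and `[ab]` of `γ` and `γ'` into the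
edges `[ac]` and `[bd]`, one obtains a polygon in `S_F`"), for boxes with moats: from a set of
edges `U` (the union of a polygon through the inner cardinal edge of `B(z)` on the side `(i,+)`
and a polygon through the inner cardinal edge of `B(z + eᵢ)` on the side `(i,-)`), delete these
two edges and add the rung edges. [cite: DuminilCopinKozmaYadin2014, §3 (proof of the Claim)] -/
def mergeEdges (n g : ℕ) (z : Site 2) (i : Fin 2) (U : Finset (Sym2 (Site 2))) :
    Finset (Sym2 (Site 2)) :=
  U \ {innerCardinalEdge n g z i true, innerCardinalEdge n g (z + Pi.single i 1) i false} ∪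
    rungEdges n g z i

/-- The data of a merge across the rung of `B(z)` towards `+eᵢ`: two polygons `E₁`, `E₂` with
vertices in disjoint regions `R₁`, `R₂` that avoid the rung cells, `E₁` through the inner
cardinal edge of `B(z)` on the side `(i,+)` and `E₂` through that of `B(z + eᵢ)` on the side
`(i,-)` (in the source: `γ' ∈ S_{F₀∖{B}}` through `[cd] ∈ 𝓔𝓒_{F₀∖{B}}` and `γ ∈ S_B` through
`[ab]`, in either order). [cite: DuminilCopinKozmaYadin2014, §3 (proof of the Claim)] -/
structure MergeData (n g : ℕ) (z : Site 2) (i : Fin 2) (R₁ R₂ : Finset (Site 2))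
    (E₁ E₂ : Finset (Sym2 (Site 2))) : Prop where
  /-- the two regions are disjoint -/
  disjoint : Disjoint R₁ R₂
  /-- the rung cells avoid both regions -/
  rung_notMem : ∀ k, 1 ≤ k → k ≤ 2 * g → ∀ t, rungPt n g z i k t ∉ R₁ ∧ rungPt n g z i k t ∉ R₂
  /-- `E₁` is a polygon -/
  isPolygon₁ : IsPolygon (zdGraph 2) E₁
  /-- with vertices in `R₁` -/
  subset₁ : E₁ ⊆ edgesIn (zdGraph 2) R₁
  /-- through the inner cardinal edge of `B(z)` on the side `(i,+)` -/
  mem₁ : innerCardinalEdge n g z i true ∈ E₁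
  /-- `E₂` is a polygon -/
  isPolygon₂ : IsPolygon (zdGraph 2) E₂
  /-- with vertices in `R₂` -/
  subset₂ : E₂ ⊆ edgesIn (zdGraph 2) R₂
  /-- through the inner cardinal edge of `B(z + eᵢ)` on the side `(i,-)` -/
  mem₂ : innerCardinalEdge n g (z + Pi.single i 1) i false ∈ E₂

/-- Membership in the rung edges. [cite: DuminilCopinKozmaYadin2014, §3 (proof of the Claim)] -/
theorem mem_rungEdges_iff {n g : ℕ} {z : Site 2} {i : Fin 2} {e : Sym2 (Site 2)} :
    e ∈ rungEdges n g z i ↔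
      ∃ k, k < 2 * g + 1 ∧ ∃ t, e = s(rungPt n g z i k t, rungPt n g z i (k + 1) t) := by
  simp only [rungEdges, Finset.mem_union, Finset.mem_image, Finset.mem_range]
  constructor
  · rintro (⟨k, hk, rfl⟩ | ⟨k, hk, rfl⟩)
    · exact ⟨k, hk, false, rfl⟩
    · exact ⟨k, hk, true, rfl⟩
  · rintro ⟨k, hk, t, rfl⟩
    cases t
    · exact Or.inl ⟨k, hk, rfl⟩
    · exact Or.inr ⟨k, hk, rfl⟩


end SupercriticalSAW

end Literature.Barriers.CriticalPhenomena
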